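import Literature.AlgebraicGeometry.ShimuraVarieties.UnitaryCurveSiegelDescent   -- ★ E5 (A-p01): the density frame `gal_comp_sliceComplex` (§3), its imports (★ `ShimuraSetGS.eq_of_forall_mk_eq`, ★ `SchemeOver.hom_ext_of_forall_algPoints`, …)
import HarnessLib

/-!
# Two `ℂ`-morphisms from the complex fibre of the unitary Shimura CURVE to a separated `ℚ`-scheme that agree on ONE Hecke orbit are EQUAL
# ([Milne 2005] Lemma 13.5 + the argument of Thm. 13.6, p. 118)

Topic `AlgebraicGeometry/ShimuraVarieties`, namespace `…ShimuraVarieties.UnitaryCanonicalModel` (the object of ★ `UnitaryShimuraCurveRecord`: the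
record system `RecordSystemGS L J⋆ τ K₀` of the canonical model of `Sh(U(J⋆), 𝔻)` over the CM field `L` along `τ`).  THEOREMS ONLY (no definition, no
instance, no notation, no named fact, no `sorry`).  Cell `hodgecm-mathlib` (D-0151), P6 «MOD programme», crux hLiu418 (stmt-HodgeConjecture-24832,
`--supports`, count-neutral), line «L4», X-LEAF `Lines/F0_P6a_EExports.lean` (A-p01 (g28)) socket `stub_ESHEET`, organ map `MEMO-ESHEET-organs.v1`
(66df4d8c) **(S3) «THE CONJUGATE SLICE EQUALS THE TENSORED SLICE: `T′ = ψ_𝔞`»** (LA4-plan (g0) DEAL #24 → LA4-p03 (g2)).  THIS FILE IS THE DENSITY STEP OF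
(S3), cut GENERICALLY — the 40-line frame of ★ E5 `RecordSystemGS.gal_comp_sliceComplex` with its two protagonists abstracted: there `T′ := σ|_L⁻¹(ψ)` and
`ψ` agree on the Hecke orbit of a special point by reciprocity (§2 of E5) and are therefore equal; here ANY two `ℂ`-morphisms `T₁, T₂ : (M_K)_τ → M_ℂ`
that agree on the Hecke orbit `{[v, bK] : b}` of ONE negative vector `v` are equal — so (S3) proper is THIS head applied to `T₁ := T′` (the
`γ̃`-conjugate of `stub_E4`'s slice, `γ̃ ∈ Aut(ℂ∕ι₁F)` reading `γ ∈ Gal(Fᵢ∕F)`) and `T₂ := ψ_𝔞` (the classifying map of the Serre-tensored family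
(S1)), the agreement on the orbit of the CM pair `[ι₁ w]` being exactly (S2a) (reciprocity with the central twist `b̃(z(s))`) + (S2b) (the Serre tensor of a
marked fibre is marked by the `b̃(z)`-translate) — consumed BY NAME as the hypothesis `h` below, in either of the two currencies of E5 (`e.symm [v, bK]` or
`baseChangeEquiv τ (pts⁻¹ [v, bK])`).  HONEST LABEL: HC_CM is proved only modulo the 2 remaining named inputs (hLiu418 24832, h413 24833) until rung 0
closes; this file is generic and count-neutral.

THE MATHEMATICS ([Milne2005ShimuraVarieties] Lemma 13.5 p. 118 «the set `{[x, a]_K}` is dense in `Sh_K(ℂ)`» and the sentence of the proof of Thm. 13.6 «it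
suffices to check this on `{[x₀, a]}`»; [GortzWedhorn2020] §(14.20) ∕ Prop. 9.19: morphisms from a reduced scheme of finite type over a field to a separated
scheme are determined by their geometric points).  `(M_K)_τ = M_K ⊗_{L,τ} ℂ` is a smooth (★ `RecordSystemGS.smooth_complexFibre`), hence reduced, curve over
`ℂ` whose complex points are `Sh_K(ℂ)` through a homeomorphism `e`; `M` is separated over `ℚ`, so `M_ℂ(ℂ)` is Hausdorff (★ `ComplexPoints.t2Space_of_isSeparated`);
`p ↦ Tᵢ(e⁻¹ p)` are continuous (★ `AlgPoints.continuous_map`), agree on the dense Hecke orbit (★ `ShimuraSetGS.eq_of_forall_mk_eq`), hence everywhere, hence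
`T₁ = T₂` (★ `SchemeOver.hom_ext_of_forall_algPoints`).

* §1 **`RecordSystemGS.sliceComplex_ext_of_heckeOrbit`** — agreement on the orbit of ONE negative `v`, read through ANY homeomorphism
  `e : (M_K)_τ(ℂ) ≃ₜ Sh_K(ℂ)`, ⇒ `T₁ = T₂`;
  `RecordSystemGS.sliceComplex_ext_of_forall_heckeOrbit` — the same with the agreement asked at every negative vector (so the empty-cone case `𝔻 = ∅` is
  vacuously included, as in E5 §3);
* §2 **`RecordSystemGS.sliceComplex_ext_of_heckeOrbit_pts`** — the same in E5 §2's currency `baseChangeEquiv τ (M_K) (pts⁻¹ [v, bK])` (the shape in which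
  ★ `map_conj_eq_sliceComplex_of_recip` and its (S2a)+(S2b) twin deliver the agreement), through the junction `he` of ★ `gal_comp_sliceComplex`.

## References
* [Milne2005ShimuraVarieties] J. S. Milne, *Introduction to Shimura varieties* (2005; rev. 2017), §13: Lemma 13.5 and Thm. 13.6 (proof) p. 118; Prop. 13.1 p. 117.
* [Deligne1971TravauxShimura] P. Deligne, *Travaux de Shimura* (1971), Prop. 5.2 (density of Hecke orbits).
* [GortzWedhorn2020] U. Görtz, T. Wedhorn, *Algebraic Geometry I* (2nd ed. 2020), Prop. 9.19 and Rem. 9.20, §(14.20).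
-/

set_option autoImplicit false

noncomputable section

open Function MulAction Topology NumberField IsDedekindDomain CategoryTheory CategoryTheory.Limits Matrix
  AlgebraicGeometry Cardinal
open scoped Matrix ComplexOrder
open Literature.AlgebraicGeometry.Motives Literature.NumberTheory.Automorphic Literature.NumberTheory.Automorphic.UnitaryGroup
open Literature.NumberTheory.Automorphic.Liu2021.AppendixC (C5.OpenCompactSubgroup C5.SmallLevel)
open Literature.AlgebraicGeometry.Motives.AbelianVariety (bcSpec bcFunctor specAut)

namespace Literature.AlgebraicGeometry.ShimuraVarieties.UnitaryCanonicalModel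

variable {L : Type} [Field L] [NumberField L] [IsCMField L] {Jstar : Matrix (Fin 2) (Fin 2) L} {τ : L →+* ℂ}
  {K₀ : C5.OpenCompactSubgroup ↥(finAdelic (↥(maximalRealSubfield L)) L (IsCMField.complexConj L) 2 Jstar)}

section HeckeOrbitExt

variable (S : RecordSystemGS L Jstar τ K₀) (K : C5.SmallLevel K₀) (M : SchemeOver ℚ) [IsSeparated M.hom]

/-! ### §1 Agreement on one Hecke orbit, read through a homeomorphism `(M_K)_τ(ℂ) ≃ₜ Sh_K(ℂ)` -/

/-- **TWO `ℂ`-MORPHISMS `(M_K)_τ → M_ℂ` THAT AGREE ON THE HECKE ORBIT OF ONE NEGATIVE VECTOR ARE EQUAL** ([Milne2005ShimuraVarieties] Lemma 13.5 +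
Thm. 13.6 (proof); the frame of ★ `RecordSystemGS.gal_comp_sliceComplex` with `σ|_L⁻¹(ψ)`, `ψ` abstracted to `T₁`, `T₂`).  `J⋆` `c`-hermitian with unit
determinant, `M` separated over `ℚ`, `e` any homeomorphism of the complex points of the complex fibre with `Sh_K(ℂ)`, `v` a negative vector; if
`T₁(e⁻¹[v, bK]) = T₂(e⁻¹[v, bK])` for every `b ∈ G(𝔸_f)`, then `T₁ = T₂`.  The (S3) step of the sheet line: `T₁ := γ̃⁻¹(ψ)`, `T₂ := ψ_𝔞`, agreement = (S2a)+(S2b).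
[cite: Milne2005ShimuraVarieties, Lemma 13.5 and Thm. 13.6 (proof) p. 118] [cite: GortzWedhorn2020, Prop. 9.19 and Rem. 9.20] -/
theorem RecordSystemGS.sliceComplex_ext_of_heckeOrbit (hJ : (Jstar.map (IsCMField.complexConj L))ᵀ = Jstar) (hdet : IsUnit Jstar.det)
    (e : letI : Algebra L ℂ := τ.toAlgebra
      ComplexPoints ((Motives.baseChangeHom τ).obj (S.M.obj K)) ≃ₜ ShimuraSetGS L Jstar τ K.1.1)
    {v : Fin 2 → ℂ} (hv : v ∈ negCone (Jstar.map τ))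
    (T₁ T₂ : (Motives.baseChangeHom τ).obj (S.M.obj K) ⟶ (Motives.baseChange ℚ ℂ).obj M)
    (h : ∀ b : ↥(finAdelic (↥(maximalRealSubfield L)) L (IsCMField.complexConj L) 2 Jstar),
      AlgPoints.map T₁ (e.symm (ShimuraSetGS.mk L Jstar τ K.1.1 v hv b)) = AlgPoints.map T₂ (e.symm (ShimuraSetGS.mk L Jstar τ K.1.1 v hv b))) :
    T₁ = T₂ := by
  letI iL : Algebra L ℂ := τ.toAlgebra
  haveI : SmoothOfRelativeDimension 1 ((Motives.baseChangeHom τ).obj (S.M.obj K)).hom := S.smooth_complexFibre K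
  haveI : Smooth ((Motives.baseChangeHom τ).obj (S.M.obj K)).hom := SmoothOfRelativeDimension.smooth 1 _
  haveI : IsReduced ((Motives.baseChangeHom τ).obj (S.M.obj K)).left :=
    isReduced_of_smooth_over_field ((Motives.baseChangeHom τ).obj (S.M.obj K)).hom
  haveI : IsSeparated ((Motives.baseChange ℚ ℂ).obj M).hom :=
    MorphismProperty.baseChange_obj (P := @IsSeparated) _ M ‹_›
  haveI : T2Space (ComplexPoints ((Motives.baseChange ℚ ℂ).obj M)) := ComplexPoints.t2Space_of_isSeparated _
  -- the two point maps `Sh_K(ℂ) → M_ℂ(ℂ)` are continuous and agree on a dense Hecke orbit, hence everywhere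
  have hfun : (fun p => AlgPoints.map T₁ (e.symm p)) = fun p => AlgPoints.map T₂ (e.symm p) :=
    ShimuraSetGS.eq_of_forall_mk_eq L Jstar τ K.1.1 hJ hdet hv
      ((AlgPoints.continuous_map T₁).comp e.symm.continuous)
      ((AlgPoints.continuous_map T₂).comp e.symm.continuous) h
  -- morphisms from the reduced complex curve to the separated `M_ℂ` are determined by their complex points
  refine SchemeOver.hom_ext_of_forall_algPoints ℂ fun P => ?_
  have h' := congrFun hfun (e P)
  simp only [Homeomorph.symm_apply_apply, AlgPoints.map_apply] at h'
  exact h'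

/-- **The same, with the agreement asked on the Hecke orbit of EVERY negative vector** — so that the empty-cone case (`𝔻 = ∅`, no complex point at all) is
covered vacuously, exactly as in ★ `RecordSystemGS.gal_comp_sliceComplex` §3. [cite: Milne2005ShimuraVarieties, Lemma 13.5 and Thm. 13.6 (proof) p. 118]
[cite: GortzWedhorn2020, Prop. 9.19 and Rem. 9.20] -/
theorem RecordSystemGS.sliceComplex_ext_of_forall_heckeOrbit (hJ : (Jstar.map (IsCMField.complexConj L))ᵀ = Jstar) (hdet : IsUnit Jstar.det)
    (e : letI : Algebra L ℂ := τ.toAlgebra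
      ComplexPoints ((Motives.baseChangeHom τ).obj (S.M.obj K)) ≃ₜ ShimuraSetGS L Jstar τ K.1.1)
    (T₁ T₂ : (Motives.baseChangeHom τ).obj (S.M.obj K) ⟶ (Motives.baseChange ℚ ℂ).obj M)
    (h : ∀ (v : Fin 2 → ℂ) (hv : v ∈ negCone (Jstar.map τ)) (b : ↥(finAdelic (↥(maximalRealSubfield L)) L (IsCMField.complexConj L) 2 Jstar)),
      AlgPoints.map T₁ (e.symm (ShimuraSetGS.mk L Jstar τ K.1.1 v hv b)) = AlgPoints.map T₂ (e.symm (ShimuraSetGS.mk L Jstar τ K.1.1 v hv b))) :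
    T₁ = T₂ := by
  letI iL : Algebra L ℂ := τ.toAlgebra
  by_cases hne : ∃ v : Fin 2 → ℂ, v ∈ negCone (Jstar.map τ)
  · obtain ⟨v, hv⟩ := hne
    exact S.sliceComplex_ext_of_heckeOrbit K M hJ hdet e hv T₁ T₂ (h v hv)
  · -- no negative vector: `Sh_K(ℂ) = ∅`, so the complex fibre has no complex point
    haveI : SmoothOfRelativeDimension 1 ((Motives.baseChangeHom τ).obj (S.M.obj K)).hom := S.smooth_complexFibre K
    haveI : Smooth ((Motives.baseChangeHom τ).obj (S.M.obj K)).hom := SmoothOfRelativeDimension.smooth 1 _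
    haveI : IsReduced ((Motives.baseChangeHom τ).obj (S.M.obj K)).left :=
      isReduced_of_smooth_over_field ((Motives.baseChangeHom τ).obj (S.M.obj K)).hom
    haveI : IsSeparated ((Motives.baseChange ℚ ℂ).obj M).hom :=
      MorphismProperty.baseChange_obj (P := @IsSeparated) _ M ‹_›
    refine SchemeOver.hom_ext_of_forall_algPoints ℂ fun P => ?_
    obtain ⟨v, hv, b, -⟩ := ShimuraSetGS.mk_surjective L Jstar τ K.1.1 (e P)
    exact absurd ⟨v, hv⟩ hne

/-! ### §2 The same in the `pts`-currency of E5 §2 (`baseChangeEquiv τ (M_K) (pts⁻¹ [v, bK])`) -/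

/-- **Agreement on one Hecke orbit in `pts`-currency ⇒ equality**: with the junction `he` of ★ `RecordSystemGS.gal_comp_sliceComplex` between the
homeomorphism `e` and the record's `pts` composed with ★ `AlgPoints.baseChangeEquiv τ`, an agreement of `T₁`, `T₂` on the points
`baseChangeEquiv τ (M_K) (pts⁻¹ [v, bK])` (the shape delivered by ★ `map_conj_eq_sliceComplex_of_recip` and by its (S2a)+(S2b) twin for the Serre-tensored slice)
gives `T₁ = T₂`. [cite: Milne2005ShimuraVarieties, Lemma 13.5 and Thm. 13.6 (proof) p. 118] [cite: GortzWedhorn2020, Prop. 9.19 and Rem. 9.20] -/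
theorem RecordSystemGS.sliceComplex_ext_of_heckeOrbit_pts (hJ : (Jstar.map (IsCMField.complexConj L))ᵀ = Jstar) (hdet : IsUnit Jstar.det)
    (e : letI : Algebra L ℂ := τ.toAlgebra
      ComplexPoints ((Motives.baseChangeHom τ).obj (S.M.obj K)) ≃ₜ ShimuraSetGS L Jstar τ K.1.1)
    (he : letI : Algebra L ℂ := τ.toAlgebra
      ∀ (v : Fin 2 → ℂ) (hv : v ∈ negCone (Jstar.map τ))
        (b : ↥(finAdelic (↥(maximalRealSubfield L)) L (IsCMField.complexConj L) 2 Jstar)),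
        e.symm (ShimuraSetGS.mk L Jstar τ K.1.1 v hv b) =
          AlgPoints.baseChangeEquiv τ (S.M.obj K) ((S.pts K).symm (ShimuraSetGS.mk L Jstar τ K.1.1 v hv b)))
    {v : Fin 2 → ℂ} (hv : v ∈ negCone (Jstar.map τ))
    (T₁ T₂ : (Motives.baseChangeHom τ).obj (S.M.obj K) ⟶ (Motives.baseChange ℚ ℂ).obj M)
    (h : letI : Algebra L ℂ := τ.toAlgebra
      ∀ b : ↥(finAdelic (↥(maximalRealSubfield L)) L (IsCMField.complexConj L) 2 Jstar),
        AlgPoints.map T₁ (AlgPoints.baseChangeEquiv τ (S.M.obj K) ((S.pts K).symm (ShimuraSetGS.mk L Jstar τ K.1.1 v hv b))) =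
          AlgPoints.map T₂ (AlgPoints.baseChangeEquiv τ (S.M.obj K) ((S.pts K).symm (ShimuraSetGS.mk L Jstar τ K.1.1 v hv b)))) :
    T₁ = T₂ :=
  S.sliceComplex_ext_of_heckeOrbit K M hJ hdet e hv T₁ T₂ fun b => by rw [he]; exact h b

end HeckeOrbitExt

end Literature.AlgebraicGeometry.ShimuraVarieties.UnitaryCanonicalModel

end
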